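import Summits.ABC.IUTFork.Repair.RHWithinPlaceFinancingHeightCap
import Summits.ABC.IUTFork.Repair.RHHeightScalingBarrier
import Summits.ABC.IUTFork.Repair.RHHeightScalingBarrierDatum
import HarnessLib

/-!
# R-H ROUND 3, AXIS D2 — class «WITHIN-PLACE FINANCING» (row D2-EXP-3) ENTERS THE HEIGHT-SCALING BARRIER BY NAME

PROOF-ONLY junction file (0 definitions, 0 `Prop` facts, no instance, no notation) between
* the class law / all-heights cap of row EXP-3 — `RHWithinPlaceFinancingHeightLaw` (p532255) and `RHWithinPlaceFinancingHeightCap` (p532824;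
  abc-iut-rh2-q2-cond g11, KEY D2-EXP-3): at EVERY height `m ≥ 0` and for EVERY label `J ≤ L` the on-slice credit obeys
  `Σ_{j ≤ J} s_j ≤ C_Π := Σ_{j ≤ L} (jδ + (j+1)G + (e−1))` (`sum_slack_le_capPi`), and
* abc-iut-rh2-w-2's BARRIER files — the abstract barrier `RHHeightScalingBarrier` (p531802: `PowerBoundFrom`, `ClosedBy`, `NeverClosedFrom`,
  `recoveredFraction`, `barrierScale`, `not_closedBy_of_heightFree`, `neverClosedFrom_barrierScale`, the worked-place witness `frey7_l107_envelope`)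
  and the datum-level barrier `RHHeightScalingBarrierDatum` (p532641: the full-price ENVELOPE `ENV(s)`, `envelope_add_tol_lt_demand_of_lt`).
Rows EXP-4 (p532789) and EXP-5 (p533038 `powerBoundFrom_credit` / `acrossNetting_not_closedBy`) already have this link; this file supplies it for EXP-3.

CURRENCY (spelled out, as in the two EXP-3 files): exact U2 cell of a place with integers `e > 0`, `δ ≥ 0`, `r_out ≤ r_in`, `G := r_in − r_out`,
height `m ≥ 0`; labels `j = 1 + k`, `k < J`; slack `s_j(m) := price_j(m) − d_j(m)` with `price_j(m) = jδ + (j+1)G + ((j²m − jδ − (j+1)r_in) mod e)` and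
`d_j(m) = (j²−1)m`; the class certifies at the place the on-slice credit `C_σ = Σ_{j ≤ j₀} s_j` (and recovers `min(C_σ, R) ≤ C_σ`). Along the HEIGHT RAY
the height is any profile `μ(s) ≥ 0` (the dilation `m ↦ s·m` of record, integer or floored, is one) and the slice boundary any `J(s) ≤ L = l⋆` — the cap
needs neither the cell hypothesis nor the shape of the profile, which is why the statements below quantify over arbitrary `μ`, `J`.

WHAT IS PROVED (namespace `Summit.ABC.IUTFork.Repair.RH.WithinPlaceFinancingHeightLaw`, continued; 0 `sorry`):
* §1 `cellSlack_le_cellPrice` (`d_j ≥ 0`), `cellPrice_nonneg`, `sum_slack_le_sum_price` (`Σ_{j ≤ J} s_j ≤ Σ_{j ≤ L} price_j`, `J ≤ L`, `m ≥ 0`).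
* §2 ABSTRACT BARRIER (p531802) BY NAME: **`powerBoundFrom_onSliceCredit`** — the credit profile `s ↦ Σ_{j ≤ J(s)} s_j(μ(s))` obeys
  `PowerBoundFrom _ 0 C_Π s₁` (mass exponent `α = 0`, i.e. recovered-fraction exponent `−1`; constant `C_Π`; any onset `s₁` from which `μ ≥ 0`, `J ≤ L`);
  `powerBoundFrom_financedMass` (the same for `min(C_σ, R)` with ANY remainder profile `R`); **`withinPlaceFinancing_not_closedBy`** — the one-object
  family never closes the requirement `M₁·s − tol` (`M₁ > 0`) at any `s ≥ s₁` with `s > (C_Π + tol)/M₁` (`not_closedBy_of_heightFree`); the same with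
  `M₁ :=` the place mass `Σ_{j ≤ L} d_j(m₁) > 0` at the base height (`placeMass_pos`); **`withinPlaceFinancing_neverClosedFrom`** (`NeverClosedFrom` from
  `barrierScale M₁ tol s₁ 0 (posConstSum C_Π)` on, `neverClosedFrom_barrierScale` with `α = a = 0`); `withinPlaceFinancing_recoveredFraction_le`
  (`recoveredFraction ≤ (2·posConstSum/M₁)·s⁻¹`); and the WEIGHTED FAMILY over finitely many places `i : Fin k` (weights `c_i ≥ 0`):
  `powerBoundFrom_weighted_onSliceCredit`, **`withinPlaceFinancing_family_not_closedBy`** (threshold `(Σ_i c_i·C_Π(i) + tol)/M₁`),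
  `withinPlaceFinancing_family_neverClosedFrom`.
* §3 DATUM-LEVEL BARRIER (p532641) BY NAME, integer dilation `m_w ↦ s·m_w`: **`weighted_onSliceCredit_le_envelope`** (`Σ_w c_w·C_σ(w, s) ≤ ENV(s)` for
  `s ≥ 0`) and **`weighted_onSliceCredit_add_tol_lt_demand_of_lt`** (beyond `s₀⁺ = (3·CAP⁺ + 6·tol)/M₆` the class's datum total plus `tol` falls strictly
  short of the demand — `envelope_add_tol_lt_demand_of_lt`).
* §4 WORKED PLACE X1 (FREY `p = 7`, `l = 107`: `e = 1605`, `m = 210·s`, `δ = 1604`, `r_in = 268`, `r_out = −4472`, `L = 53`): `row_frey7_l107_capPi_eq_envelope`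
  (the EXP-3 cap `C_Π` IS the barrier's audited envelope constant `9 414 496` — `frey7_l107_priceEnvelope` BY NAME), `row_frey7_l107_onSliceCredit_le_envelope`
  (every `s ≥ 0`, every `J ≤ 53`), `row_frey7_l107_onSliceCredit_lt_mass` (`< 10 707 060·s` for `s ≥ 1`, `frey7_l107_mass_dilate` BY NAME),
  `row_frey7_l107_onSliceCredit_le_barrierEnvelope` (the floored real ray `m = 210·⌊s⌋` is dominated by `frey7_l107_envelope`), and
  **`row_frey7_l107_withinPlace_neverClosed`**: `NeverClosedFrom` (EXP-3 object at X1) `10 707 060 0 1` — by `closedBy_mono` from `frey7_l107_envelope_neverClosed`.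
HONEST FRAMING: integer / real inequalities about OUR typed cell currency and the barrier's claim-tagged hypothesis frame; «never closes» concerns the
certified object class fed into the frame, not [IUTchIII] Cor. 3.12 in print; nothing here asserts that abc is proved or refuted, that Cor. 3.12 /
[IUTchIV] Thm. 1.10 holds or fails at any datum, or takes a side on any author; typed ≠ proved; computed ≠ proved for the bed link.
[cite: Mochizuki2012, IUTchIV Prop. 1.2 (i)(ii) p. 10, Prop. 1.4 p. 13; IUTchIII Cor. 3.12 p. 173–174] [claim: Mochizuki2012, status: disputed]
-/

namespace Summit.ABC.IUTFork.Repair.RH.WithinPlaceFinancingHeightLaw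

open Finset
open Summit.ABC.IUTFork.Repair.RH.DiffPricedHull Summit.ABC.IUTFork.Repair.RH.HullCellSlice
open Summit.ABC.IUTFork.Repair.RH.HullCellSlackSum
open Summit.ABC.IUTFork.Repair.RH.HeightScalingBarrier

/-! ## §1. Termwise: slack ≤ price, price ≥ 0; the on-slice credit is under the place's exact price total -/

/-- `s_j(m) ≤ price_j(m)` for `m ≥ 0` (the demand `d_j = (j²−1)·m` is non-negative). [folklore] -/
theorem cellSlack_le_cellPrice (e δ rin rout : ℤ) {m : ℤ} (hm : 0 ≤ m) (k : ℕ) :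
    ((1 + (k : ℤ)) * δ + (1 + (k : ℤ) + 1) * (rin - rout) +
        ((1 + (k : ℤ)) ^ 2 * m - (1 + (k : ℤ)) * δ - (1 + (k : ℤ) + 1) * rin) % e) - ((1 + (k : ℤ)) ^ 2 - 1) * m
      ≤ (1 + (k : ℤ)) * δ + (1 + (k : ℤ) + 1) * (rin - rout) +
        ((1 + (k : ℤ)) ^ 2 * m - (1 + (k : ℤ)) * δ - (1 + (k : ℤ) + 1) * rin) % e := by
  have hk0 : (0 : ℤ) ≤ (k : ℤ) := Int.natCast_nonneg k
  have hd : 0 ≤ ((1 + (k : ℤ)) ^ 2 - 1) * m := mul_nonneg (by nlinarith) hm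
  linarith

/-- `0 ≤ price_j(m)` for `0 < e`, `0 ≤ δ`, `r_out ≤ r_in` (any height `m`: the residue is `≥ 0` by `gain_bounds`). [folklore] -/
theorem cellPrice_nonneg {e δ rin rout : ℤ} (he : 0 < e) (hδ : 0 ≤ δ) (hio : rout ≤ rin) (m : ℤ) (k : ℕ) :
    0 ≤ (1 + (k : ℤ)) * δ + (1 + (k : ℤ) + 1) * (rin - rout) +
        ((1 + (k : ℤ)) ^ 2 * m - (1 + (k : ℤ)) * δ - (1 + (k : ℤ) + 1) * rin) % e := by
  have hk0 : (0 : ℤ) ≤ (k : ℤ) := Int.natCast_nonneg k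
  have hρ := (gain_bounds he m (1 + (k : ℤ)) δ rin).1
  have h1 : 0 ≤ (1 + (k : ℤ)) * δ := mul_nonneg (by linarith) hδ
  have h2 : 0 ≤ (1 + (k : ℤ) + 1) * (rin - rout) := mul_nonneg (by linarith) (by linarith)
  linarith

/-- **On-slice credit ≤ the place's exact price total**: `Σ_{j ≤ J} s_j(m) ≤ Σ_{j ≤ L} price_j(m)` for `m ≥ 0`, `J ≤ L`
(slack ≤ price termwise, prices non-negative so the sum only grows from `J` to `L`). The termwise form of abc-iut-rh2-w-2's
«every combination is under the envelope» for this class. [folklore] -/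
theorem sum_slack_le_sum_price {e m δ rin rout : ℤ} (he : 0 < e) (hδ : 0 ≤ δ) (hio : rout ≤ rin) (hm : 0 ≤ m)
    {J L : ℕ} (hJL : J ≤ L) :
    ∑ k ∈ range J, (((1 + (k : ℤ)) * δ + (1 + (k : ℤ) + 1) * (rin - rout) +
        ((1 + (k : ℤ)) ^ 2 * m - (1 + (k : ℤ)) * δ - (1 + (k : ℤ) + 1) * rin) % e) - ((1 + (k : ℤ)) ^ 2 - 1) * m)
      ≤ ∑ k ∈ range L, ((1 + (k : ℤ)) * δ + (1 + (k : ℤ) + 1) * (rin - rout) +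
        ((1 + (k : ℤ)) ^ 2 * m - (1 + (k : ℤ)) * δ - (1 + (k : ℤ) + 1) * rin) % e) :=
  calc ∑ k ∈ range J, (((1 + (k : ℤ)) * δ + (1 + (k : ℤ) + 1) * (rin - rout) +
        ((1 + (k : ℤ)) ^ 2 * m - (1 + (k : ℤ)) * δ - (1 + (k : ℤ) + 1) * rin) % e) - ((1 + (k : ℤ)) ^ 2 - 1) * m)
      ≤ ∑ k ∈ range J, ((1 + (k : ℤ)) * δ + (1 + (k : ℤ) + 1) * (rin - rout) +
        ((1 + (k : ℤ)) ^ 2 * m - (1 + (k : ℤ)) * δ - (1 + (k : ℤ) + 1) * rin) % e) :=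
        sum_le_sum fun k _ => cellSlack_le_cellPrice e δ rin rout hm k
    _ ≤ ∑ k ∈ range L, ((1 + (k : ℤ)) * δ + (1 + (k : ℤ) + 1) * (rin - rout) +
        ((1 + (k : ℤ)) ^ 2 * m - (1 + (k : ℤ)) * δ - (1 + (k : ℤ) + 1) * rin) % e) :=
        sum_le_sum_of_subset_of_nonneg (range_mono hJL) fun k _ _ => cellPrice_nonneg he hδ hio m k

/-! ## §2. The class enters the abstract barrier (p531802) BY NAME: mass exponent `0`, constant `C_Π` -/

/-- **EXP-3 ENTERS `Barrier` WITH `α = 0`.** For a place (`0 < e`, `0 ≤ δ`, `r_out ≤ r_in`, `L` labels), ANY height profile `μ` along the ray with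
`μ(s) ≥ 0` from `s₁` on and ANY slice boundary `J(s) ≤ L` from `s₁` on, the on-slice credit profile `s ↦ Σ_{j ≤ J(s)} s_j(μ(s))` obeys abc-iut-rh2-w-2's
mass law `PowerBoundFrom _ 0 C_Π s₁` with `C_Π = Σ_{j ≤ L} (jδ + (j+1)G + (e−1))` (`sum_slack_le_capPi` + `powerBoundFrom_zero_of_heightFree`): mass
exponent `0`, recovered-fraction exponent `−1`. [folklore] -/
theorem powerBoundFrom_onSliceCredit {e δ rin rout : ℤ} (he : 0 < e) (hδ : 0 ≤ δ) (hio : rout ≤ rin) {L : ℕ}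
    {μ : ℝ → ℤ} {J : ℝ → ℕ} {s₁ : ℝ} (hμ : ∀ s, s₁ ≤ s → 0 ≤ μ s) (hJ : ∀ s, s₁ ≤ s → J s ≤ L) :
    PowerBoundFrom
      (fun s => ((∑ k ∈ range (J s), (((1 + (k : ℤ)) * δ + (1 + (k : ℤ) + 1) * (rin - rout) +
          ((1 + (k : ℤ)) ^ 2 * μ s - (1 + (k : ℤ)) * δ - (1 + (k : ℤ) + 1) * rin) % e) - ((1 + (k : ℤ)) ^ 2 - 1) * μ s) : ℤ) : ℝ))
      0 ((∑ k ∈ range L, ((1 + (k : ℤ)) * δ + (1 + (k : ℤ) + 1) * (rin - rout) + (e - 1)) : ℤ) : ℝ) s₁ := by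
  refine powerBoundFrom_zero_of_heightFree fun s hs => ?_
  exact_mod_cast sum_slack_le_capPi he hδ hio (hμ s hs) (hJ s hs)

/-- The class RECOVERS `min(C_σ, R) ≤ C_σ`: with ANY remainder profile `R`, the financed mass `s ↦ min(C_σ(s), R(s))` obeys the same mass law
`PowerBoundFrom _ 0 C_Π s₁`. [folklore] -/
theorem powerBoundFrom_financedMass {e δ rin rout : ℤ} (he : 0 < e) (hδ : 0 ≤ δ) (hio : rout ≤ rin) {L : ℕ}
    {μ : ℝ → ℤ} {J : ℝ → ℕ} {s₁ : ℝ} (hμ : ∀ s, s₁ ≤ s → 0 ≤ μ s) (hJ : ∀ s, s₁ ≤ s → J s ≤ L) (R : ℝ → ℝ) :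
    PowerBoundFrom
      (fun s => min ((∑ k ∈ range (J s), (((1 + (k : ℤ)) * δ + (1 + (k : ℤ) + 1) * (rin - rout) +
          ((1 + (k : ℤ)) ^ 2 * μ s - (1 + (k : ℤ)) * δ - (1 + (k : ℤ) + 1) * rin) % e) - ((1 + (k : ℤ)) ^ 2 - 1) * μ s) : ℤ) : ℝ) (R s))
      0 ((∑ k ∈ range L, ((1 + (k : ℤ)) * δ + (1 + (k : ℤ) + 1) * (rin - rout) + (e - 1)) : ℤ) : ℝ) s₁ := by
  refine powerBoundFrom_zero_of_heightFree fun s hs => ?_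
  refine le_trans (min_le_left _ _) ?_
  exact_mod_cast sum_slack_le_capPi he hδ hio (hμ s hs) (hJ s hs)

/-- **THE ONE-OBJECT FAMILY «within-place financing at one place» NEVER CLOSES beyond the crossing** (conductor-type case of the barrier, SHARP,
`not_closedBy_of_heightFree` BY NAME): against a requirement `M₁·s − tol` of positive slope, at every `s ≥ s₁` with `s > (C_Π + tol)/M₁` the credit
profile does not close it. [folklore] -/
theorem withinPlaceFinancing_not_closedBy {e δ rin rout : ℤ} (he : 0 < e) (hδ : 0 ≤ δ) (hio : rout ≤ rin) {L : ℕ}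
    {μ : ℝ → ℤ} {J : ℝ → ℕ} {s₁ : ℝ} (hμ : ∀ s, s₁ ≤ s → 0 ≤ μ s) (hJ : ∀ s, s₁ ≤ s → J s ≤ L)
    {M₁ tol s : ℝ} (hM : 0 < M₁) (hs₁ : s₁ ≤ s)
    (hs : (((∑ k ∈ range L, ((1 + (k : ℤ)) * δ + (1 + (k : ℤ) + 1) * (rin - rout) + (e - 1)) : ℤ) : ℝ) + tol) / M₁ < s) :
    ¬ ClosedBy
      (fun (_ : Fin 1) (s : ℝ) => ((∑ k ∈ range (J s), (((1 + (k : ℤ)) * δ + (1 + (k : ℤ) + 1) * (rin - rout) +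
          ((1 + (k : ℤ)) ^ 2 * μ s - (1 + (k : ℤ)) * δ - (1 + (k : ℤ) + 1) * rin) % e) - ((1 + (k : ℤ)) ^ 2 - 1) * μ s) : ℤ) : ℝ))
      M₁ tol s := by
  refine not_closedBy_of_heightFree
    (C := fun _ : Fin 1 => ((∑ k ∈ range L, ((1 + (k : ℤ)) * δ + (1 + (k : ℤ) + 1) * (rin - rout) + (e - 1)) : ℤ) : ℝ))
    (s₁ := s₁) hM (fun _ s' hs' => ?_) hs₁ ?_
  · exact_mod_cast sum_slack_le_capPi he hδ hio (hμ s' hs') (hJ s' hs')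
  · simpa only [Fin.sum_univ_one] using hs

/-- **The same with the requirement slope read off the place**: `M₁ :=` the place mass `Σ_{j ≤ L} d_j(m₁) = m₁·S(L)` at the base height `m₁ > 0`
(`L ≥ 2`; positive by `placeMass_pos`) — along the dilation `m₁ ↦ s·m₁` the place's trivial mass is `M₁·s` exactly, and the class never closes
`M₁·s − tol` at any `s ≥ s₁` beyond `(C_Π + tol)/M₁`. [folklore] -/
theorem withinPlaceFinancing_not_closedBy_placeMass {e δ rin rout : ℤ} (he : 0 < e) (hδ : 0 ≤ δ) (hio : rout ≤ rin) {L : ℕ}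
    (hL : 2 ≤ L) {m₁ : ℤ} (hm₁ : 0 < m₁)
    {μ : ℝ → ℤ} {J : ℝ → ℕ} {s₁ : ℝ} (hμ : ∀ s, s₁ ≤ s → 0 ≤ μ s) (hJ : ∀ s, s₁ ≤ s → J s ≤ L)
    {tol s : ℝ} (hs₁ : s₁ ≤ s)
    (hs : (((∑ k ∈ range L, ((1 + (k : ℤ)) * δ + (1 + (k : ℤ) + 1) * (rin - rout) + (e - 1)) : ℤ) : ℝ) + tol) /
        ((∑ k ∈ range L, ((1 + (k : ℤ)) ^ 2 - 1) * m₁ : ℤ) : ℝ) < s) :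
    ¬ ClosedBy
      (fun (_ : Fin 1) (s : ℝ) => ((∑ k ∈ range (J s), (((1 + (k : ℤ)) * δ + (1 + (k : ℤ) + 1) * (rin - rout) +
          ((1 + (k : ℤ)) ^ 2 * μ s - (1 + (k : ℤ)) * δ - (1 + (k : ℤ) + 1) * rin) % e) - ((1 + (k : ℤ)) ^ 2 - 1) * μ s) : ℤ) : ℝ))
      ((∑ k ∈ range L, ((1 + (k : ℤ)) ^ 2 - 1) * m₁ : ℤ) : ℝ) tol s :=
  withinPlaceFinancing_not_closedBy he hδ hio hμ hJ (by exact_mod_cast placeMass_pos hm₁ hL) hs₁ hs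

/-- **`NeverClosedFrom` at the barrier's closed-form threshold** (`neverClosedFrom_barrierScale` BY NAME with `α = a = 0`): the one-object family
never closes `M₁·s − tol` from `barrierScale M₁ tol s₁ 0 (posConstSum (C_Π))` on. [folklore] -/
theorem withinPlaceFinancing_neverClosedFrom {e δ rin rout : ℤ} (he : 0 < e) (hδ : 0 ≤ δ) (hio : rout ≤ rin) {L : ℕ}
    {μ : ℝ → ℤ} {J : ℝ → ℕ} {s₁ : ℝ} (hμ : ∀ s, s₁ ≤ s → 0 ≤ μ s) (hJ : ∀ s, s₁ ≤ s → J s ≤ L)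
    {M₁ : ℝ} (hM : 0 < M₁) (tol : ℝ) :
    NeverClosedFrom
      (fun (_ : Fin 1) (s : ℝ) => ((∑ k ∈ range (J s), (((1 + (k : ℤ)) * δ + (1 + (k : ℤ) + 1) * (rin - rout) +
          ((1 + (k : ℤ)) ^ 2 * μ s - (1 + (k : ℤ)) * δ - (1 + (k : ℤ) + 1) * rin) % e) - ((1 + (k : ℤ)) ^ 2 - 1) * μ s) : ℤ) : ℝ))
      M₁ tol
      (barrierScale M₁ tol s₁ 0 (posConstSum fun _ : Fin 1 =>
        ((∑ k ∈ range L, ((1 + (k : ℤ)) * δ + (1 + (k : ℤ) + 1) * (rin - rout) + (e - 1)) : ℤ) : ℝ))) :=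
  neverClosedFrom_barrierScale (α := fun _ : Fin 1 => (0 : ℝ))
    (C := fun _ : Fin 1 => ((∑ k ∈ range L, ((1 + (k : ℤ)) * δ + (1 + (k : ℤ) + 1) * (rin - rout) + (e - 1)) : ℤ) : ℝ))
    hM zero_lt_one (fun _ => le_rfl) fun _ => powerBoundFrom_onSliceCredit he hδ hio hμ hJ

/-- **RECOVERED-FRACTION READING, exponent `−1`** (`recoveredFraction_le_of_heightFree` BY NAME): at every `s ≥ s₁`, `s > 0` with `2·tol ≤ M₁·s`
the class recovers at most the fraction `(2·posConstSum(C_Π)/M₁)·s⁻¹` of the requirement. [folklore] -/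
theorem withinPlaceFinancing_recoveredFraction_le {e δ rin rout : ℤ} (he : 0 < e) (hδ : 0 ≤ δ) (hio : rout ≤ rin) {L : ℕ}
    {μ : ℝ → ℤ} {J : ℝ → ℕ} {s₁ : ℝ} (hμ : ∀ s, s₁ ≤ s → 0 ≤ μ s) (hJ : ∀ s, s₁ ≤ s → J s ≤ L)
    {M₁ tol s : ℝ} (hM : 0 < M₁) (hs₁ : s₁ ≤ s) (hs0 : 0 < s) (htol : 2 * tol ≤ M₁ * s) :
    recoveredFraction
      (fun (_ : Fin 1) (s : ℝ) => ((∑ k ∈ range (J s), (((1 + (k : ℤ)) * δ + (1 + (k : ℤ) + 1) * (rin - rout) +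
          ((1 + (k : ℤ)) ^ 2 * μ s - (1 + (k : ℤ)) * δ - (1 + (k : ℤ) + 1) * rin) % e) - ((1 + (k : ℤ)) ^ 2 - 1) * μ s) : ℤ) : ℝ))
      M₁ tol s ≤
      2 * posConstSum (fun _ : Fin 1 =>
        ((∑ k ∈ range L, ((1 + (k : ℤ)) * δ + (1 + (k : ℤ) + 1) * (rin - rout) + (e - 1)) : ℤ) : ℝ)) / M₁ * s⁻¹ :=
  recoveredFraction_le_of_heightFree hM (fun _ s' hs' => by
    exact_mod_cast sum_slack_le_capPi he hδ hio (hμ s' hs') (hJ s' hs')) hs₁ hs0 htol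

variable {k : ℕ}

/-- **WEIGHTED FAMILY over finitely many places** (`i : Fin k`, weights `c_i ≥ 0` — the capsule weights turning cell units into nats): each weighted
credit profile `s ↦ c_i·Σ_{j ≤ J_i(s)} s_j^{(i)}(μ_i(s))` obeys `PowerBoundFrom _ 0 (c_i·C_Π(i)) s₁`. [folklore] -/
theorem powerBoundFrom_weighted_onSliceCredit {e δ rin rout : Fin k → ℤ} (he : ∀ i, 0 < e i) (hδ : ∀ i, 0 ≤ δ i)
    (hio : ∀ i, rout i ≤ rin i) {L : ℕ} {c : Fin k → ℝ} (hc : ∀ i, 0 ≤ c i)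
    {μ : Fin k → ℝ → ℤ} {J : Fin k → ℝ → ℕ} {s₁ : ℝ} (hμ : ∀ i s, s₁ ≤ s → 0 ≤ μ i s) (hJ : ∀ i s, s₁ ≤ s → J i s ≤ L)
    (i : Fin k) :
    PowerBoundFrom
      (fun s => c i * ((∑ n ∈ range (J i s), (((1 + (n : ℤ)) * δ i + (1 + (n : ℤ) + 1) * (rin i - rout i) +
          ((1 + (n : ℤ)) ^ 2 * μ i s - (1 + (n : ℤ)) * δ i - (1 + (n : ℤ) + 1) * rin i) % e i) -
            ((1 + (n : ℤ)) ^ 2 - 1) * μ i s) : ℤ) : ℝ))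
      0 (c i * ((∑ n ∈ range L, ((1 + (n : ℤ)) * δ i + (1 + (n : ℤ) + 1) * (rin i - rout i) + (e i - 1)) : ℤ) : ℝ)) s₁ := by
  refine powerBoundFrom_zero_of_heightFree fun s hs => ?_
  refine mul_le_mul_of_nonneg_left ?_ (hc i)
  exact_mod_cast sum_slack_le_capPi (he i) (hδ i) (hio i) (hμ i s hs) (hJ i s hs)

/-- **EVERY FINITE COMBINATION OF WITHIN-PLACE-FINANCING OBJECTS NEVER CLOSES beyond the crossing** (`not_closedBy_of_heightFree` BY NAME): with
weights `c_i ≥ 0`, a requirement `M₁·s − tol` of positive slope is not closed by the family at any `s ≥ s₁` with `s > (Σ_i c_i·C_Π(i) + tol)/M₁`. [folklore] -/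
theorem withinPlaceFinancing_family_not_closedBy {e δ rin rout : Fin k → ℤ} (he : ∀ i, 0 < e i) (hδ : ∀ i, 0 ≤ δ i)
    (hio : ∀ i, rout i ≤ rin i) {L : ℕ} {c : Fin k → ℝ} (hc : ∀ i, 0 ≤ c i)
    {μ : Fin k → ℝ → ℤ} {J : Fin k → ℝ → ℕ} {s₁ : ℝ} (hμ : ∀ i s, s₁ ≤ s → 0 ≤ μ i s) (hJ : ∀ i s, s₁ ≤ s → J i s ≤ L)
    {M₁ tol s : ℝ} (hM : 0 < M₁) (hs₁ : s₁ ≤ s)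
    (hs : (∑ i, c i * ((∑ n ∈ range L, ((1 + (n : ℤ)) * δ i + (1 + (n : ℤ) + 1) * (rin i - rout i) + (e i - 1)) : ℤ) : ℝ)
        + tol) / M₁ < s) :
    ¬ ClosedBy
      (fun i (s : ℝ) => c i * ((∑ n ∈ range (J i s), (((1 + (n : ℤ)) * δ i + (1 + (n : ℤ) + 1) * (rin i - rout i) +
          ((1 + (n : ℤ)) ^ 2 * μ i s - (1 + (n : ℤ)) * δ i - (1 + (n : ℤ) + 1) * rin i) % e i) -
            ((1 + (n : ℤ)) ^ 2 - 1) * μ i s) : ℤ) : ℝ))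
      M₁ tol s := by
  refine not_closedBy_of_heightFree
    (C := fun i => c i * ((∑ n ∈ range L, ((1 + (n : ℤ)) * δ i + (1 + (n : ℤ) + 1) * (rin i - rout i) + (e i - 1)) : ℤ) : ℝ))
    (s₁ := s₁) hM (fun i s' hs' => ?_) hs₁ hs
  refine mul_le_mul_of_nonneg_left ?_ (hc i)
  exact_mod_cast sum_slack_le_capPi (he i) (hδ i) (hio i) (hμ i s' hs') (hJ i s' hs')

/-- The weighted family's `NeverClosedFrom` at the barrier's closed-form threshold (`α = a = 0`). [folklore] -/
theorem withinPlaceFinancing_family_neverClosedFrom {e δ rin rout : Fin k → ℤ} (he : ∀ i, 0 < e i) (hδ : ∀ i, 0 ≤ δ i)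
    (hio : ∀ i, rout i ≤ rin i) {L : ℕ} {c : Fin k → ℝ} (hc : ∀ i, 0 ≤ c i)
    {μ : Fin k → ℝ → ℤ} {J : Fin k → ℝ → ℕ} {s₁ : ℝ} (hμ : ∀ i s, s₁ ≤ s → 0 ≤ μ i s) (hJ : ∀ i s, s₁ ≤ s → J i s ≤ L)
    {M₁ : ℝ} (hM : 0 < M₁) (tol : ℝ) :
    NeverClosedFrom
      (fun i (s : ℝ) => c i * ((∑ n ∈ range (J i s), (((1 + (n : ℤ)) * δ i + (1 + (n : ℤ) + 1) * (rin i - rout i) +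
          ((1 + (n : ℤ)) ^ 2 * μ i s - (1 + (n : ℤ)) * δ i - (1 + (n : ℤ) + 1) * rin i) % e i) -
            ((1 + (n : ℤ)) ^ 2 - 1) * μ i s) : ℤ) : ℝ))
      M₁ tol
      (barrierScale M₁ tol s₁ 0 (posConstSum fun i =>
        c i * ((∑ n ∈ range L, ((1 + (n : ℤ)) * δ i + (1 + (n : ℤ) + 1) * (rin i - rout i) + (e i - 1)) : ℤ) : ℝ))) :=
  neverClosedFrom_barrierScale (α := fun _ : Fin k => (0 : ℝ))
    (C := fun i => c i * ((∑ n ∈ range L, ((1 + (n : ℤ)) * δ i + (1 + (n : ℤ) + 1) * (rin i - rout i) + (e i - 1)) : ℤ) : ℝ))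
    hM zero_lt_one (fun _ => le_rfl) fun i => powerBoundFrom_weighted_onSliceCredit he hδ hio hc hμ hJ i

/-! ## §3. The class is under the datum-level envelope (p532641) BY NAME: integer dilation `m_w ↦ s·m_w` -/

variable {n : ℕ}

/-- **`Σ_w c_w·C_σ(w, s) ≤ ENV(s)`**: along the integer dilation `m_w ↦ s·m_w` (`s ≥ 0`, `m_w ≥ 0`, weights `c_w ≥ 0`, slice boundaries `J_w ≤ L`) the
class's weighted datum total is under abc-iut-rh2-w-2's full-price envelope (`sum_slack_le_sum_price` per place). [folklore] -/
theorem weighted_onSliceCredit_le_envelope (e m δ rin rout : Fin n → ℤ) (c : Fin n → ℝ) (L : ℕ) (s : ℤ) (J : Fin n → ℕ)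
    (he : ∀ w, 0 < e w) (hδ : ∀ w, 0 ≤ δ w) (hio : ∀ w, rout w ≤ rin w) (hm : ∀ w, 0 ≤ m w) (hs : 0 ≤ s)
    (hc : ∀ w, 0 ≤ c w) (hJ : ∀ w, J w ≤ L) :
    ∑ w, c w * ((∑ k ∈ range (J w), (((1 + (k : ℤ)) * δ w + (1 + (k : ℤ) + 1) * (rin w - rout w) +
        ((1 + (k : ℤ)) ^ 2 * (s * m w) - (1 + (k : ℤ)) * δ w - (1 + (k : ℤ) + 1) * rin w) % e w) -
          ((1 + (k : ℤ)) ^ 2 - 1) * (s * m w)) : ℤ) : ℝ) ≤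
      ∑ w, c w * ((∑ k ∈ range L, ((1 + (k : ℤ)) * δ w + (1 + (k : ℤ) + 1) * (rin w - rout w) +
        ((1 + (k : ℤ)) ^ 2 * (s * m w) - (1 + (k : ℤ)) * δ w - (1 + (k : ℤ) + 1) * rin w) % e w) : ℤ) : ℝ) := by
  refine sum_le_sum fun w _ => mul_le_mul_of_nonneg_left ?_ (hc w)
  exact_mod_cast sum_slack_le_sum_price (he w) (hδ w) (hio w) (mul_nonneg hs (hm w)) (hJ w)

/-- **THE DATUM-LEVEL BARRIER FOR THIS CLASS** (`envelope_add_tol_lt_demand_of_lt` BY NAME): beyond `s₀⁺ = (3·CAP⁺ + 6·tol)/M₆`, i.e. when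
`3·Σ_w c_w·((δ_w+G_w)L(L+1) + 2G_wL + 2(e_w−1)L) + 6·tol < s·Σ_w c_w·m_w·L(L−1)(2L+5)`, the class's weighted datum total plus the tolerance falls
STRICTLY short of the demand `DEM(s)` — no combination of within-place-financing objects closes the requirement at any such integer dilation. [folklore] -/
theorem weighted_onSliceCredit_add_tol_lt_demand_of_lt (e m δ rin rout : Fin n → ℤ) (c : Fin n → ℝ) (L : ℕ) (s : ℤ)
    (J : Fin n → ℕ) (tol : ℝ)
    (he : ∀ w, 0 < e w) (hδ : ∀ w, 0 ≤ δ w) (hio : ∀ w, rout w ≤ rin w) (hm : ∀ w, 0 ≤ m w) (hs : 0 ≤ s)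
    (hc : ∀ w, 0 ≤ c w) (hJ : ∀ w, J w ≤ L)
    (hlt : 3 * ∑ w, c w * (((δ w + (rin w - rout w)) * ((L : ℤ) * (L + 1)) + 2 * (rin w - rout w) * L + 2 * (e w - 1) * L : ℤ) : ℝ)
        + 6 * tol < (s : ℝ) * ∑ w, c w * ((m w * ((L : ℤ) * (L - 1) * (2 * L + 5)) : ℤ) : ℝ)) :
    ∑ w, c w * ((∑ k ∈ range (J w), (((1 + (k : ℤ)) * δ w + (1 + (k : ℤ) + 1) * (rin w - rout w) +
        ((1 + (k : ℤ)) ^ 2 * (s * m w) - (1 + (k : ℤ)) * δ w - (1 + (k : ℤ) + 1) * rin w) % e w) -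
          ((1 + (k : ℤ)) ^ 2 - 1) * (s * m w)) : ℤ) : ℝ) + tol <
      ∑ w, c w * ((∑ k ∈ range L, (((1 + (k : ℤ)) ^ 2 - 1) * (s * m w)) : ℤ) : ℝ) := by
  have h1 := weighted_onSliceCredit_le_envelope e m δ rin rout c L s J he hδ hio hm hs hc hJ
  have h2 := Summit.ABC.IUTFork.Repair.RH.HeightScalingBarrierDatum.envelope_add_tol_lt_demand_of_lt
    e m δ rin rout c L s tol he hc hlt
  linarith

/-! ## §4. Worked place X1 (FREY `p = 7`, `l = 107`): the EXP-3 cap IS the barrier's audited envelope constant; the class never closes there -/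

/-- **`C_Π(X1) = 9 414 496` — the barrier's own constant.** The EXP-3 cap at the worked place (`row_frey7_l107_capPi`, with `e − 1 = 1605 − 1`) is
LITERALLY abc-iut-rh2-w-2's `frey7_l107_priceEnvelope` (p531802 §3, written with `1604`). [folklore] -/
theorem row_frey7_l107_capPi_eq_envelope :
    ∑ k ∈ range 53, ((1 + (k : ℤ)) * 1604 + (1 + (k : ℤ) + 1) * (268 - (-4472)) + (1605 - 1)) = 9414496 := by
  rw [show (1605 : ℤ) - 1 = 1604 by norm_num]
  exact frey7_l107_priceEnvelope

/-- **At X1 the on-slice credit is under the envelope at EVERY dilation `s ≥ 0` and EVERY slice boundary `J ≤ 53`** (`sum_slack_le_capPi` at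
`e = 1605`, `m = 210·s`, `δ = 1604`, `r_in = 268`, `r_out = −4472`, `L = 53`). [folklore] -/
theorem row_frey7_l107_onSliceCredit_le_envelope (s : ℤ) (hs : 0 ≤ s) {J : ℕ} (hJ : J ≤ 53) :
    ∑ k ∈ range J, (((1 + (k : ℤ)) * 1604 + (1 + (k : ℤ) + 1) * (268 - (-4472)) +
        ((1 + (k : ℤ)) ^ 2 * (210 * s) - (1 + (k : ℤ)) * 1604 - (1 + (k : ℤ) + 1) * 268) % 1605) -
          ((1 + (k : ℤ)) ^ 2 - 1) * (210 * s)) ≤ 9414496 := by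
  rw [← row_frey7_l107_capPi_eq_envelope]
  exact sum_slack_le_capPi (e := 1605) (m := 210 * s) (δ := 1604) (rin := 268) (rout := -4472)
    (by norm_num) (by norm_num) (by norm_num) (by linarith) hJ

/-- **At X1 the credit never reaches the tol-free requirement on the ray**: for every integer dilation `s ≥ 1` and every `J ≤ 53`,
`Σ_{j ≤ J} s_j(210·s) < Σ_{j ≤ 53} (j²−1)·210·s = 10 707 060·s` (`frey7_l107_mass_dilate` BY NAME; `9 414 496 < 10 707 060`). [folklore] -/
theorem row_frey7_l107_onSliceCredit_lt_mass (s : ℤ) (hs : 1 ≤ s) {J : ℕ} (hJ : J ≤ 53) :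
    ∑ k ∈ range J, (((1 + (k : ℤ)) * 1604 + (1 + (k : ℤ) + 1) * (268 - (-4472)) +
        ((1 + (k : ℤ)) ^ 2 * (210 * s) - (1 + (k : ℤ)) * 1604 - (1 + (k : ℤ) + 1) * 268) % 1605) -
          ((1 + (k : ℤ)) ^ 2 - 1) * (210 * s))
      < ∑ k ∈ range 53, (((1 + (k : ℤ)) ^ 2 - 1) * (210 * s)) := by
  rw [frey7_l107_mass_dilate]
  have h := row_frey7_l107_onSliceCredit_le_envelope s (by linarith) hJ
  linarith

/-- **The floored real ray at X1 is dominated by the barrier's witness family**: with the height profile `m = 210·⌊s⌋` (`s ≥ 0`) and any slice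
boundary `J(s) ≤ 53`, the EXP-3 object is pointwise `≤ frey7_l107_envelope` (`= 9 414 496`). [folklore] -/
theorem row_frey7_l107_onSliceCredit_le_barrierEnvelope {J : ℝ → ℕ} (hJ : ∀ s, J s ≤ 53) (i : Fin 1) (s : ℝ) (hs : 0 ≤ s) :
    ((∑ k ∈ range (J s), (((1 + (k : ℤ)) * 1604 + (1 + (k : ℤ) + 1) * (268 - (-4472)) +
        ((1 + (k : ℤ)) ^ 2 * (210 * ⌊s⌋) - (1 + (k : ℤ)) * 1604 - (1 + (k : ℤ) + 1) * 268) % 1605) -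
          ((1 + (k : ℤ)) ^ 2 - 1) * (210 * ⌊s⌋)) : ℤ) : ℝ) ≤ frey7_l107_envelope i s := by
  have hfl : (0 : ℤ) ≤ ⌊s⌋ := Int.floor_nonneg.2 hs
  have h := row_frey7_l107_onSliceCredit_le_envelope ⌊s⌋ hfl (hJ s)
  simp only [frey7_l107_envelope]
  exact_mod_cast h

/-- **EXP-3 AT X1 NEVER CLOSES FROM `s = 1` ON** (`closedBy_mono` + `frey7_l107_envelope_neverClosed` BY NAME): the one-object family
«within-place financing at the worked place, height `210·⌊s⌋`, any slice boundary `≤ 53`» satisfies `NeverClosedFrom _ 10 707 060 0 1` — the barrier's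
conclusion at its own satisfiability witness, now for the class of row EXP-3. [folklore] -/
theorem row_frey7_l107_withinPlace_neverClosed {J : ℝ → ℕ} (hJ : ∀ s, J s ≤ 53) :
    NeverClosedFrom
      (fun (_ : Fin 1) (s : ℝ) => ((∑ k ∈ range (J s), (((1 + (k : ℤ)) * 1604 + (1 + (k : ℤ) + 1) * (268 - (-4472)) +
        ((1 + (k : ℤ)) ^ 2 * (210 * ⌊s⌋) - (1 + (k : ℤ)) * 1604 - (1 + (k : ℤ) + 1) * 268) % 1605) -
          ((1 + (k : ℤ)) ^ 2 - 1) * (210 * ⌊s⌋)) : ℤ) : ℝ))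
      10707060 0 1 := by
  intro s hs h
  have hs0 : (0 : ℝ) ≤ s := le_trans zero_le_one hs
  exact frey7_l107_envelope_neverClosed s hs
    (closedBy_mono (suppliedMass_mono fun i => row_frey7_l107_onSliceCredit_le_barrierEnvelope hJ i s hs0) h)

end Summit.ABC.IUTFork.Repair.RH.WithinPlaceFinancingHeightLaw
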